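import Mathlib
import HarnessLib
import Summits.HubbardSuperconductivity.HubbardSuperconductivity.Theorems.KLProgrammeKLRegimeSplitPairLadderV4
import Summits.HubbardSuperconductivity.HubbardSuperconductivity.Theorems.KLProgrammeKLRegimeSplitPairFrozen
import Summits.HubbardSuperconductivity.HubbardSuperconductivity.Theorems.KLProgrammeKLRegimeSplitRowZeroMajorant
import Summits.HubbardSuperconductivity.HubbardSuperconductivity.Theorems.KLProgrammeKLRegimeSplitSpin01

/-!
# Route `KLProgramme` — row 0′ on the V4 engine slot for EVERY total momentum: (B1-v2) `PairArrayAt … n` from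
# `PairLadderStepAtV4` / `PairValueIncrementAtV4` at the scales `≤ n` (hence from `EngineBoundsAtV4S j`, `j ≤ n`)

Cell gate-hubbard-kl, seat hubbard-kl-r2d-p1 (child `KLRegimeBetaSplit`); V4 twin of p3's `pairArray_envelope_v3` /
`pairArrayAt_of_engineBoundsV3_explicit` (`KLProgrammeKLRegimeSplitPairArrayV3`).  Ladder while the total momentum is in the pair class
(`pairLadder_envelope_v4`, the remainder's thermal layer and ENTRY-LOCALISED leg dressing absorbed by `sWaveCascade_envelope_sources`),
frozen increments afterwards (p3's `pairFrozen_increment_extra` with the extra per-step term `X j = thermalBar j + legDressBar j`, summed by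
p1's `thermalBar_sum_le` / `legDressBar_sum_le`), frozen from scale `0` around the bare `U` for momenta never in a pair class.
**`pairArray_envelope_v4`**, **`pairArrayAt_of_ladder_v4`**, **`pairArrayAt_of_engineBoundsV4S`** (the conjuncts of `EngineBoundsAtV4S`)
and **`pairArrayAt_of_engineBoundsV4S_explicit`** (the constant chosen: `C_W ≥ 8(Σ_χ(abot+atop)+1) + 17(aplus Klam² Z + cloc Klam²(1−4^{-θ})⁻¹ + 1)
+ 1 + 235·CF·Klam²`, smallness `2·CR·Klam³·|U| ≤ 1`, volume `17·Σ_{j<n} CL β j/L ≤ U²`, and the two no-onset lines).  Everything is proved.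
-/

noncomputable section

namespace Summit.HubbardSuperconductivity.HubbardSuperconductivity.Theorems.KLRegimeSplit

set_option linter.dupNamespace false -- summit = problem name (single-conjunct summit), D-0017

open Finset Literature.MathematicalPhysics.QuantumLattice Literature.Probability.LatticeModels
open Summit.HubbardSuperconductivity.HubbardSuperconductivity.Theorems.KLProgrammeLegKernels
open Summit.HubbardSuperconductivity.HubbardSuperconductivity.Theorems.CooperChannelRiccatiFlow

section Model

variable (L M : ℕ) [NeZero L] [NeZero M]

variable {G : GeoConsts} {P : SplitConsts} {Qc : EngConsts}

/-- **Row 0′ on the V4 slot, every total momentum.**  From `PairLadderStepAtV4` at all `j ≤ n`, `PairValueIncrementAtV4` at all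
`1 ≤ j ≤ n`, `U ≥ 0`, `n ≤ n_β` and the no-onset smallness: for every `Qm` there is `u ∈ [0, U]` with
`|𝒞_n(Q;k,k') − u| ≤ 8·(A + R) + (3·CF(Klam U)² + (4/3 + 20)·CF(Klam U)² + Σ_{i<n} ē_i)` on the ball. -/
theorem pairArray_envelope_v4 (hG : G.WF) (hP : P.WF) (hQc : Qc.WF) {β U μ : ℝ} {K : TrigPolyC4v} (hU : 0 ≤ U) {n : ℕ}
    (hn : n ≤ nScales β) (hsteps : ∀ j ≤ n, PairLadderStepAtV4 L M G P Qc β U μ K j)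
    (hincr : ∀ j, 1 ≤ j → j ≤ n → PairValueIncrementAtV4 L M G P Qc β U μ K j) (Qm : TorusSite 2 L)
    (hsmall : 8 * 20 * ((initDevBar G U + ∑ j ∈ range n, (drivePBar G P U j + eremBar G P Qc U β L j) +
        (4 / 3 + 20) * (G.CF * (P.Klam * U) ^ 2)) +
        (∑ j ∈ range n, (drivePBar G P U j + eremBar G P Qc U β L j) + 5 * (G.CF * (P.Klam * U) ^ 2))) *
      (G.bhi * n) ≤ 1) :
    ∃ u : ℝ, 0 ≤ u ∧ u ≤ U ∧ ∀ k ∈ klBall L μ K, ∀ k' ∈ klBall L μ K,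
      ‖klPairAmplitude L M β U μ K n Qm k k' - (u : ℂ)‖ ≤
        8 * ((initDevBar G U + ∑ j ∈ range n, (drivePBar G P U j + eremBar G P Qc U β L j) +
            (4 / 3 + 20) * (G.CF * (P.Klam * U) ^ 2)) +
          (∑ j ∈ range n, (drivePBar G P U j + eremBar G P Qc U β L j) + 5 * (G.CF * (P.Klam * U) ^ 2))) +
        ((P.Klam * U) ^ 2 * (3 * G.CF) + (4 / 3 + 20) * (G.CF * (P.Klam * U) ^ 2) +
          ∑ i ∈ range n, eremBar G P Qc U β L i) := by
  classical
  set τ : ℕ → ℝ := fun j => drivePBar G P U j + eremBar G P Qc U β L j with hτ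
  have hτ0 : ∀ j, 0 ≤ τ j := fun j => add_nonneg (drivePBar_nonneg' hG U j) (eremBar_nonneg' hG hP hQc U β L j)
  have hbhi : 0 ≤ G.bhi := hG.2.2.1.trans hG.2.2.2.1
  have hCF : 0 ≤ G.CF := hG.2.2.2.2.2.2.2.2.2.2.2.2.2.1
  set g2 : ℝ := G.CF * (P.Klam * U) ^ 2 with hg2
  have hg20 : 0 ≤ g2 := by positivity
  have hinit0 : 0 ≤ initDevBar G U := by
    unfold initDevBar
    refine mul_nonneg (add_nonneg (sum_nonneg fun χ _ => add_nonneg (hG.2.1 χ) (hG.1 χ)) zero_le_one) (sq_nonneg U)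
  have hSe0 : 0 ≤ ∑ i ∈ range n, eremBar G P Qc U β L i := sum_nonneg fun i _ => eremBar_nonneg' hG hP hQc U β L i
  -- the frozen part between two scales `t ≤ n` once the pair momentum is resolved at `t + 1`
  have hfrozen : ∀ t, t ≤ n → ((4 : ℝ) ^ (t + 1))⁻¹ < torusSupNorm (latticeMomentum L Qm 0, latticeMomentum L Qm 1) →
      ∀ k ∈ klBall L μ K, ∀ k' ∈ klBall L μ K,
        ‖klPairAmplitude L M β U μ K n Qm k k' - klPairAmplitude L M β U μ K t Qm k k'‖ ≤
          (P.Klam * U) ^ 2 * (3 * G.CF) + (4 / 3 + 20) * g2 + ∑ i ∈ range n, eremBar G P Qc U β L i := by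
    intro t htn hexit
    refine pairFrozen_increment_extra L M hG hP hQc htn
      (fun j k k' => thermalBar G P U β j + legDressBar G P U (legSliceCount L μ K j ![k', Qm - k', Qm - k, k]))
      (fun j hj hjn k hk k' hk' => ?_) (fun k hk k' hk' => ?_) hexit
    · have h := hincr j (by omega) hjn (by omega) Qm k hk k' hk'
      simp only [klTorusNorm] at h
      linarith
    · have h1 : ∑ j ∈ Ioc t n, thermalBar G P U β j ≤ 4 / 3 * g2 :=
        (sum_le_sum_of_subset_of_nonneg (fun j hj => by simp only [mem_Ioc] at hj; exact mem_range.2 (by omega))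
          fun j _ _ => thermalBar_nonneg hCF P U β j).trans (thermalBar_sum_le hCF P U β hn)
      have h2 : ∑ j ∈ Ioc t n, legDressBar G P U (legSliceCount L μ K j ![k', Qm - k', Qm - k, k]) ≤ 20 * g2 :=
        (sum_le_sum_of_subset_of_nonneg (fun j hj => by simp only [mem_Ioc] at hj; exact mem_range.2 (by omega))
          fun j _ _ => legDressBar_nonneg hCF P U _).trans (legDressBar_sum_le L hCF P U μ K _ n)
      rw [sum_add_distrib]
      linarith
  by_cases hQ0 : IsPairClassAt L Qm 0
  · -- the last pair-class scale `t`
    set t : ℕ := Nat.findGreatest (fun s => IsPairClassAt L Qm s) n with ht_def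
    have htn : t ≤ n := Nat.findGreatest_le n
    have hQt : IsPairClassAt L Qm t := Nat.findGreatest_spec (P := fun s => IsPairClassAt L Qm s) (Nat.zero_le n) hQ0
    -- monotonicity of the majorants in the horizon
    have hSt : ∑ j ∈ range t, τ j ≤ ∑ j ∈ range n, τ j :=
      sum_le_sum_of_subset_of_nonneg (range_mono htn) fun j _ _ => hτ0 j
    have hSt0 : 0 ≤ ∑ j ∈ range t, τ j := sum_nonneg fun j _ => hτ0 j
    have hsmall' : 8 * 20 * ((initDevBar G U + ∑ j ∈ range t, τ j + (4 / 3 + 20) * g2) +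
        (∑ j ∈ range t, τ j + 5 * g2)) * (G.bhi * t) ≤ 1 := by
      refine le_trans ?_ hsmall
      have ht' : (t : ℝ) ≤ n := by exact_mod_cast htn
      have h1 : (initDevBar G U + ∑ j ∈ range t, τ j + (4 / 3 + 20) * g2) + (∑ j ∈ range t, τ j + 5 * g2) ≤
          (initDevBar G U + ∑ j ∈ range n, τ j + (4 / 3 + 20) * g2) + (∑ j ∈ range n, τ j + 5 * g2) := by linarith
      have hSn0 : 0 ≤ ∑ j ∈ range n, τ j := sum_nonneg fun j _ => hτ0 j
      have hX0 : 0 ≤ (initDevBar G U + ∑ j ∈ range n, τ j + (4 / 3 + 20) * g2) + (∑ j ∈ range n, τ j + 5 * g2) := by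
        nlinarith [hinit0, hg20, hSn0]
      exact mul_le_mul (mul_le_mul_of_nonneg_left h1 (by norm_num)) (mul_le_mul_of_nonneg_left ht' hbhi)
        (mul_nonneg hbhi (Nat.cast_nonneg t)) (mul_nonneg (by norm_num) hX0)
    obtain ⟨u, hu0, huU, hu⟩ := pairLadder_envelope_v4 L M hG hP hQc hU (n := t) (htn.trans hn)
      (fun j hj => hsteps j (hj.trans htn)) hQt hsmall'
    refine ⟨u, hu0, huU, fun k hk k' hk' => ?_⟩
    have hfro : ‖klPairAmplitude L M β U μ K n Qm k k' - klPairAmplitude L M β U μ K t Qm k k'‖ ≤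
        (P.Klam * U) ^ 2 * (3 * G.CF) + (4 / 3 + 20) * g2 + ∑ i ∈ range n, eremBar G P Qc U β L i := by
      rcases htn.eq_or_lt with h | h
      · rw [h, sub_self, norm_zero]
        have : 0 ≤ (P.Klam * U) ^ 2 * (3 * G.CF) := by positivity
        linarith [hSe0, hg20]
      · have hnot : ¬ IsPairClassAt L Qm (t + 1) :=
          Nat.findGreatest_is_greatest (P := fun s => IsPairClassAt L Qm s) (Nat.lt_succ_self t) (Nat.succ_le_of_lt h)
        exact hfrozen t htn (lt_of_not_ge hnot) k hk k' hk'
    have hlad := hu k hk k' hk'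
    calc ‖klPairAmplitude L M β U μ K n Qm k k' - (u : ℂ)‖
        ≤ ‖klPairAmplitude L M β U μ K t Qm k k' - (u : ℂ)‖ +
            ‖klPairAmplitude L M β U μ K n Qm k k' - klPairAmplitude L M β U μ K t Qm k k'‖ := by
          rw [show klPairAmplitude L M β U μ K n Qm k k' - (u : ℂ) =
            (klPairAmplitude L M β U μ K t Qm k k' - (u : ℂ)) +
              (klPairAmplitude L M β U μ K n Qm k k' - klPairAmplitude L M β U μ K t Qm k k') by ring]
          exact norm_add_le _ _
      _ ≤ _ := by
          refine (add_le_add hlad hfro).trans ?_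
          simp only [hτ] at hSt ⊢
          nlinarith [hSt, hg20, hinit0, hSt0]
  · -- never in the pair class: frozen from scale 0 around the bare value `U`
    have hexit : ((4 : ℝ) ^ (0 + 1))⁻¹ < torusSupNorm (latticeMomentum L Qm 0, latticeMomentum L Qm 1) := by
      have h1 : ¬ torusSupNorm (latticeMomentum L Qm 0, latticeMomentum L Qm 1) ≤ ((4 : ℝ) ^ 0)⁻¹ := hQ0
      push Not at h1
      exact lt_trans (by norm_num) h1
    refine ⟨U, hU, le_rfl, fun k hk k' hk' => ?_⟩
    have hfro := hfrozen 0 (Nat.zero_le n) hexit k hk k' hk'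
    have h0 := (hsteps 0 (Nat.zero_le n)).1 rfl Qm k hk k' hk'
    have hS0 : 0 ≤ ∑ j ∈ range n, τ j := sum_nonneg fun j _ => hτ0 j
    calc ‖klPairAmplitude L M β U μ K n Qm k k' - (U : ℂ)‖
        ≤ ‖klPairAmplitude L M β U μ K n Qm k k' - klPairAmplitude L M β U μ K 0 Qm k k'‖ +
            ‖klPairAmplitude L M β U μ K 0 Qm k k' - (U : ℂ)‖ := by
          rw [show klPairAmplitude L M β U μ K n Qm k k' - (U : ℂ) =
            (klPairAmplitude L M β U μ K n Qm k k' - klPairAmplitude L M β U μ K 0 Qm k k') +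
              (klPairAmplitude L M β U μ K 0 Qm k k' - (U : ℂ)) by ring]
          exact norm_add_le _ _
      _ ≤ _ := by
          refine (add_le_add hfro h0).trans ?_
          simp only [hτ] at hS0
          nlinarith [hS0, hg20, hinit0]

/-- **Packaging into (B1-v2)**: if the row-0′ V4 majorant is within `P.C_W·U²`, then `PairArrayAt L M P β U μ K n`. -/
theorem pairArrayAt_of_ladder_v4 (hG : G.WF) (hP : P.WF) (hQc : Qc.WF) {β U μ : ℝ} {K : TrigPolyC4v} (hU : 0 ≤ U) {n : ℕ}
    (hn : n ≤ nScales β) (hsteps : ∀ j ≤ n, PairLadderStepAtV4 L M G P Qc β U μ K j)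
    (hincr : ∀ j, 1 ≤ j → j ≤ n → PairValueIncrementAtV4 L M G P Qc β U μ K j)
    (hsmall : 8 * 20 * ((initDevBar G U + ∑ j ∈ range n, (drivePBar G P U j + eremBar G P Qc U β L j) +
        (4 / 3 + 20) * (G.CF * (P.Klam * U) ^ 2)) +
        (∑ j ∈ range n, (drivePBar G P U j + eremBar G P Qc U β L j) + 5 * (G.CF * (P.Klam * U) ^ 2))) *
      (G.bhi * n) ≤ 1)
    (hCW : 8 * ((initDevBar G U + ∑ j ∈ range n, (drivePBar G P U j + eremBar G P Qc U β L j) +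
            (4 / 3 + 20) * (G.CF * (P.Klam * U) ^ 2)) +
          (∑ j ∈ range n, (drivePBar G P U j + eremBar G P Qc U β L j) + 5 * (G.CF * (P.Klam * U) ^ 2))) +
        ((P.Klam * U) ^ 2 * (3 * G.CF) + (4 / 3 + 20) * (G.CF * (P.Klam * U) ^ 2) +
          ∑ i ∈ range n, eremBar G P Qc U β L i) ≤ P.C_W * U ^ 2) :
    PairArrayAt L M P β U μ K n := by
  intro Qm
  obtain ⟨u, hu0, huU, hu⟩ := pairArray_envelope_v4 L M hG hP hQc hU hn hsteps hincr Qm hsmall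
  exact ⟨u, hu0, huU.trans (by rw [abs_of_nonneg hU]; linarith), fun k hk k' hk' => (hu k hk k' hk').trans hCW⟩

/-- **Supplier-map row 0′ on the V5 slots, literally**: the engine bounds `EngineBoundsAtV4S` at every scale `j ≤ n` carry
`PairLadderStepAtV4 j` and `PairValueIncrementAtV4 j`, hence give (B1-v2) `PairArrayAt` at `n` once the smallness and the constant
line are supplied. -/
theorem pairArrayAt_of_engineBoundsV4S (hG : G.WF) (hP : P.WF) (hQc : Qc.WF) {β U μ : ℝ} {K : TrigPolyC4v} (hU : 0 ≤ U) {n : ℕ}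
    (hn : n ≤ nScales β) (hE : ∀ j ≤ n, EngineBoundsAtV4S L M G P Qc β U μ K j)
    (hsmall : 8 * 20 * ((initDevBar G U + ∑ j ∈ range n, (drivePBar G P U j + eremBar G P Qc U β L j) +
        (4 / 3 + 20) * (G.CF * (P.Klam * U) ^ 2)) +
        (∑ j ∈ range n, (drivePBar G P U j + eremBar G P Qc U β L j) + 5 * (G.CF * (P.Klam * U) ^ 2))) *
      (G.bhi * n) ≤ 1)
    (hCW : 8 * ((initDevBar G U + ∑ j ∈ range n, (drivePBar G P U j + eremBar G P Qc U β L j) +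
            (4 / 3 + 20) * (G.CF * (P.Klam * U) ^ 2)) +
          (∑ j ∈ range n, (drivePBar G P U j + eremBar G P Qc U β L j) + 5 * (G.CF * (P.Klam * U) ^ 2))) +
        ((P.Klam * U) ^ 2 * (3 * G.CF) + (4 / 3 + 20) * (G.CF * (P.Klam * U) ^ 2) +
          ∑ i ∈ range n, eremBar G P Qc U β L i) ≤ P.C_W * U ^ 2) :
    PairArrayAt L M P β U μ K n :=
  pairArrayAt_of_ladder_v4 L M hG hP hQc hU hn (fun j hj => (hE j hj).2.2.1) (fun j _ hj => (hE j hj).2.2.2.1) hsmall hCW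

/-- **Row 0′ on the V5 slots with the constant chosen.**  With
`C := 8(Σ_χ(abot+atop)+1) + 17(aplus Klam² Z + cloc Klam² (1−4^{-θ})⁻¹ + 1) + 1 + 235·CF·Klam² ≤ P.C_W`, the `Q`-dependent smallness
`2·CR·Klam³·|U| ≤ 1`, the volume line `17·Σ_{j<n} CL β j/L ≤ U²` and the NO-ONSET line
`8·20·((Σ_χ(abot+atop)+1) + 2(aplus Klam² Z + cloc Klam² (1−4^{-θ})⁻¹ + 1) + 1 + 27·CF·Klam²)·U²·(bhi·n) ≤ 1`, the engine bounds at the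
scales `≤ n ≤ n_β` give `PairArrayAt L M P β U μ K n`. -/
theorem pairArrayAt_of_engineBoundsV4S_explicit (hG : G.WF) (hP : P.WF) (hQc : Qc.WF) {β U μ : ℝ} {K : TrigPolyC4v}
    (hU : 0 ≤ U) {n : ℕ} (hn : n ≤ nScales β) (hE : ∀ j ≤ n, EngineBoundsAtV4S L M G P Qc β U μ K j)
    (hUCR : 2 * Qc.CR * P.Klam ^ 3 * |U| ≤ 1) (hL : 17 * ∑ j ∈ range n, Qc.CL β j / L ≤ U ^ 2)
    (hsmall : 8 * 20 * (((∑ χ : D4Irrep, (G.abot χ + G.atop χ) + 1) +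
        2 * (G.aplus * P.Klam ^ 2 * G.Z + G.cloc * P.Klam ^ 2 * (1 - (4 : ℝ) ^ (-G.θ))⁻¹ + 1) + 1 +
          27 * (G.CF * P.Klam ^ 2)) * U ^ 2) * (G.bhi * n) ≤ 1)
    (hCW : 8 * (∑ χ : D4Irrep, (G.abot χ + G.atop χ) + 1) +
        17 * (G.aplus * P.Klam ^ 2 * G.Z + G.cloc * P.Klam ^ 2 * (1 - (4 : ℝ) ^ (-G.θ))⁻¹ + 1) + 1 +
          235 * (G.CF * P.Klam ^ 2) ≤ P.C_W) :
    PairArrayAt L M P β U μ K n := by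
  have hdrive := drivePBar_sum_le (P := P) hG U n
  have herem := eremBar_sum_le hG hP hQc U β L n
  have hU2 : 0 ≤ U ^ 2 := sq_nonneg U
  have hCL0 : 0 ≤ ∑ j ∈ range n, Qc.CL β j / L := sum_nonneg fun j _ => div_nonneg (hQc.2.2.2.2.2.2.2 β j) (Nat.cast_nonneg L)
  have hθ : 0 < G.θ := hG.2.2.2.2.2.1
  have hg : 0 ≤ (1 - (4 : ℝ) ^ (-G.θ))⁻¹ :=
    inv_nonneg.2 (by have := Real.rpow_lt_one_of_one_lt_of_neg (x := (4 : ℝ)) (by norm_num) (by linarith : -G.θ < 0); linarith)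
  have hK0 : 0 ≤ P.Klam := zero_le_one.trans hP.1
  have hcloc : 0 ≤ G.cloc := hG.2.2.2.2.1
  have haplus : 0 ≤ G.aplus := hG.2.2.2.2.2.2.2.2.2.2.1
  have hCF : 0 ≤ G.CF := hG.2.2.2.2.2.2.2.2.2.2.2.2.2.1
  have hCR : 0 ≤ Qc.CR := hQc.2.1
  have hbhi : 0 ≤ G.bhi := hG.2.2.1.trans hG.2.2.2.1
  have hab : 0 ≤ ∑ χ : D4Irrep, (G.abot χ + G.atop χ) := sum_nonneg fun χ _ => add_nonneg (hG.2.1 χ) (hG.1 χ)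
  have hK2 : 0 ≤ P.Klam ^ 2 * U ^ 2 := by positivity
  have hZ : 0 ≤ G.Z := le_trans (sum_nonneg fun j _ => hG.2.2.2.2.2.2.2.2.1 j) (hG.2.2.2.2.2.2.2.2.2.1 0)
  have hCRU : 2 * Qc.CR * P.Klam ^ 3 * |U| * U ^ 2 ≤ U ^ 2 := by nlinarith
  -- the sum `S = Σ_{j<n}(drivePBar + ē)` is `≤ (aplus Klam² Z + cloc Klam² g + 2 CR Klam³|U|)·U² + Σ CL/L`
  have hS : ∑ j ∈ range n, (drivePBar G P U j + eremBar G P Qc U β L j) ≤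
      (G.aplus * P.Klam ^ 2 * G.Z + G.cloc * P.Klam ^ 2 * (1 - (4 : ℝ) ^ (-G.θ))⁻¹ + 2 * Qc.CR * P.Klam ^ 3 * |U|) * U ^ 2 +
        ∑ j ∈ range n, Qc.CL β j / L := by
    rw [sum_add_distrib]; nlinarith [hdrive, herem]
  have hS0 : 0 ≤ ∑ j ∈ range n, (drivePBar G P U j + eremBar G P Qc U β L j) :=
    sum_nonneg fun j _ => add_nonneg (drivePBar_nonneg' hG U j) (eremBar_nonneg' hG hP hQc U β L j)
  have hinit : initDevBar G U = (∑ χ : D4Irrep, (G.abot χ + G.atop χ) + 1) * U ^ 2 := rfl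
  have hn0 : (0 : ℝ) ≤ n := Nat.cast_nonneg n
  refine pairArrayAt_of_engineBoundsV4S L M hG hP hQc hU hn hE ?_ ?_
  · refine le_trans ?_ hsmall
    have hmain : (initDevBar G U + ∑ j ∈ range n, (drivePBar G P U j + eremBar G P Qc U β L j) +
        (4 / 3 + 20) * (G.CF * (P.Klam * U) ^ 2)) +
        (∑ j ∈ range n, (drivePBar G P U j + eremBar G P Qc U β L j) + 5 * (G.CF * (P.Klam * U) ^ 2)) ≤
        ((∑ χ : D4Irrep, (G.abot χ + G.atop χ) + 1) +
          2 * (G.aplus * P.Klam ^ 2 * G.Z + G.cloc * P.Klam ^ 2 * (1 - (4 : ℝ) ^ (-G.θ))⁻¹ + 1) + 1 +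
            27 * (G.CF * P.Klam ^ 2)) * U ^ 2 := by
      rw [hinit]; nlinarith [hS, hCRU, hL, hCL0, mul_nonneg hCF hK2]
    have h0 : 0 ≤ (initDevBar G U + ∑ j ∈ range n, (drivePBar G P U j + eremBar G P Qc U β L j) +
        (4 / 3 + 20) * (G.CF * (P.Klam * U) ^ 2)) +
        (∑ j ∈ range n, (drivePBar G P U j + eremBar G P Qc U β L j) + 5 * (G.CF * (P.Klam * U) ^ 2)) := by
      rw [hinit]; positivity
    exact mul_le_mul_of_nonneg_right (mul_le_mul_of_nonneg_left hmain (by norm_num)) (mul_nonneg hbhi hn0)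
  · rw [hinit]
    have herem' : ∑ i ∈ range n, eremBar G P Qc U β L i ≤
        (G.cloc * P.Klam ^ 2 * (1 - (4 : ℝ) ^ (-G.θ))⁻¹ + 2 * Qc.CR * P.Klam ^ 3 * |U|) * U ^ 2 +
          ∑ j ∈ range n, Qc.CL β j / L := herem
    nlinarith [hS, herem', hCRU, hL, hCL0, mul_nonneg hCF hK2, mul_nonneg hcloc hK2, mul_nonneg haplus (mul_nonneg hK2 hZ),
      mul_nonneg hab hU2, mul_nonneg hg (mul_nonneg hcloc hK2), mul_nonneg (mul_nonneg hCR (pow_nonneg hK0 3)) (abs_nonneg U)]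

end Model

end Summit.HubbardSuperconductivity.HubbardSuperconductivity.Theorems.KLRegimeSplit

end
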